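import Summits.QuantumFields.BalabanUV.T4Continuum.Support.BalabanMinimizerLaw
import Summits.QuantumFields.BalabanUV.Beta.GAN24.ChainLeibniz

/-!
# `BalabanUV.Beta.GAN24.SoftColumnVertexRate` — binder row G-an2-4 ∕ (CONV-C), route R7 «TWO CURRENCIES», step S4 EXECUTED ON TYPED
# BAŁABAN OBJECTS: the local vertex chains of the `U = 1` SOFT-MINIMISER COLUMNS (NE2-P1's tower `BalabanMinimizerLaw.Mtil`, Bałaban's
# vector `𝒢 = Δ_a⁻¹` (1.83) + averaging (1.18), King's isometric staircase `Jpc`) have the ONE-STEP SUP RATE `θ₁ = L⁻¹` MODULO ONE SUP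
# LETTER; the two-leg Gram pairing `M̃_kᴴM̃_k` has it UNCONDITIONALLY

NOT IN PRINT; OUR PROOF ATTEMPT (prover part P3 of row G-an2-4, fibre∕strip («Woodbury») lineage, gen 25; CRUX TEAM (2), ruling «YM
REDIRECT TOWARDS THE SUMMIT», 2026-08-21: «work the best two candidate routes of record»).  HONEST DEPENDENCY (cell records, verbatim):
«continuum YM on T⁴ ⇐ BetaPertH ∧ nine spine estimates (0/9 proved); BetaPertH ⇐ (D1) ∧ (D4) ∧ CAP+tail; G-an2-4 gates asym, D1 and
NE2/3/4.»  HONEST FRAMING (cell contract, verbatim): «discharging `BetaPertH` makes Bałaban's UV stability UNCONDITIONAL — a real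
constructive-QFT result; it is NOT the continuum limit and NOT the Clay problem.»  ABSOLUTE RULE: nothing printed is a hypothesis; no
`def … : Prop`, no sorry; [folklore] algebra + Cauchy–Schwarz over TREE objects BY NAME.

## The objects (all TREE, NE2-P1 lineage `T4Continuum/Support/BalabanMinimizerLaw` ∕ `BalabanAveragedTowerUnit`, `U = 1`, every torus `M`,
## every `L ≥ 1`, every `d`, every `a > 0`)

 * `idx L M k = Tor (fine (L^k) M) × Fin d` — vector fields on the lattice of spacing `L^{−k}`;
 * `Mtil L M a ha k : Matrix (idx k) (idx 0) ℂ` — THE SOFT MINIMISER MAP `M̃_k = n_k^{d/2}·a·𝒢^{(L^{−k})}·QBtow_kᴴ` ([B5] (1.68)–(1.71), King's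
   `a_kG_kQ_k^*`, in the `ℓ²` normalisation; `n_k = L^k`), whose COLUMN `q ↦ M̃_k e_q` is the unit-sourced soft leg; the PHYSICAL leg (pointwise
   `O(1)`) is `u_q = n_k^{d/2}·M̃_k e_q`;
 * `Jpc L M k` — King's pairing as an ISOMETRIC staircase `(J_k u)(x′) = L^{−d/2}·u(par x′)` (`Jpc_conjTranspose_mul_Jpc : J_kᴴJ_k = 1`);
 * **`opNorm_Mtil_succ_sub_le`**: `‖M̃_{k+1} − J_kM̃_k‖ ≤ a·CQH(d,a)·L^{−k}` — THE `ℓ²` ONE-STEP LAW OF THE LEGS (R7's (ρ3) value part, TREE).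

## What is proved here (route R7 of `HOME/beta/ROUTES-GAN24.md` v6 §2, S4 «Leibniz» with S3 (ρ3)-value and NORM DEMOTION (ii))

 * §1 `Jpc_mulVec_apply` (the staircase's entries), `opNorm_Mtil_le` (`‖M̃_k‖ ≤ a·Cst(d,a)`, k-uniform), the column tools
   (`nsq_col_Mtil_le`, `nsq_col_step_le`: the DIFFERENCED column `(M̃_{k+1} − J_kM̃_k)e_q` has `ℓ²` size `≤ a·CQH·L^{−k}`);
 * §2 **UNCONDITIONAL**: the two-leg Gram pairing `W_k(p,r) := (M̃_kᴴM̃_k)(p,r) = ⟨M̃_ke_p, M̃_ke_r⟩` (the unit-lattice kernel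
   `a²·n_k^d·QBtow_k𝒢²QBtow_kᴴ`) obeys **`norm_gram_succ_sub_le`** `‖W_{k+1}(p,r) − W_k(p,r)‖ ≤ 2·(a·Cst)·(a·CQH)·L^{−k}` — by
   `M̃′ᴴM̃′ − M̃ᴴM̃ = M̃′ᴴ(M̃′ − JM̃) + (M̃′ − JM̃)ᴴ(JM̃)` and `JᴴJ = 1`; no letter;
 * §3 the local vertex functional on the tower, PHYSICALLY normalised: `V₃ k c f g h := √(n_k^d)·vtx₃ c f g h` (`ChainLeibniz.vtx₃`), and
   the EXACT TRANSPORT **`V₃_transport`** `V₃ (k+1) c (J f) (J g) (J h) = V₃ k c f g h` (each `L`-block of the finer torus has `L^d` sites: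
   `BalabanBlockPoincare.tileEquiv` + `ChainLeibniz.sum_comp_fst_equiv`; **`sum_comp_par`**);
 * §4 **THE ONE-STEP SUP RATE OF THE COLUMN VERTEX CHAINS, MODULO ONE SUP LETTER** `hcol : ∀ k q X, √(n_k^d)·‖M̃_k X q‖ ≤ C_∞` (the k-uniform
   POINTWISE bound of the physical column `a·n_k^d·(𝒢Q_k^*e_q)(x)` — [B5] (1.65)∕(1.110)-TYPE, a sup BOUND, not a rate; DISPLAYED, not in the
   tree on this carrier): **`V₃_col_succ_sub_le`**
   `‖V₃ (k+1) c [cols_{k+1} p q r] − V₃ k c [cols_k p q r]‖ ≤ 3·‖c‖₁·C_∞·(a·Cst)·(a·CQH)·L^{−k}`: SupRate with `θ₁ = L⁻¹` for EVERY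
   coefficient tensor `c` over components (R7 (P-R7a)'s toy column `V0 = ⟨u_y, h_b u_{y′}⟩` is `V₃`; the four-column twin `V₄` — the
   value-level SHAPE of AN1 Table T row T1's `ad*_h ad_{h′}` bracket between two legs — is the companion `GAN24/SoftColumnVertexRateFour`).
   MECHANISM = R7 verbatim: transport (exact) + Leibniz (exact) + the differenced column in `ℓ²` (TREE law) + ONE neighbour in sup (the
   letter) + the other in `ℓ²` (`‖M̃‖ ≤ a·Cst`): «no sup-norm RATE of any fine leg, only sup BOUNDS; no sub-averaging».

HONEST SCOPE.  MODEL chains on typed objects: no claim that `V₃∕V₄` IS a Table-T row of (MF′) (the chain list S1 and the jet identification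
S7 are an2's ∕ p1's); SOFT columns (the hard∕constrained `H_k` of [B5] (1.63)∕(1.103) = soft ∘ unit-lattice factor is road P2's
`HardMinimiserOneStepSup` ∕ (U-SINV)); value-level vertices only (no `∇` on a leg: (ρ3)'s gradient line and (ρ2) are NOT here); `U = 1`;
§4 is CONDITIONAL on the displayed letter `hcol` (candidate suppliers, not asked: road P2's sup letters ∕ the (1.110) leaves, on THEIR
carriers `B5DeltaA169.DeltaA` — a dictionary to `calG` would be needed).  Supplier work on the route of record; zero on the D1 grid;
NOT (CONV-C) (a list), NOT (ρ2)(ρ3), NEVER «G-an2-4 closed», NOT D1, NOT BetaPertH, NOT continuum, NOT Clay.  Locators (text only):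
[Balaban1984PropagatorsI] (1.18) p. 20, (1.68)–(1.71) p. 29, (1.83) p. 31; [King1986] Prop. 3.8 p. 664–665.  Provenance:
prover-b2b-balaban-gan24-p3-g25-0 (unit `b2b-balaban-gan24-p3`, gen 25), 2026-08-21.
-/

noncomputable section

open scoped BigOperators ComplexConjugate Matrix Matrix.Norms.L2Operator
open Finset

namespace Summit.QuantumFields.BalabanUV.Beta.GAN24.SoftColumnVertexRate

open Literature.MathematicalPhysics.QuantumFieldTheory.Balaban1983to89.B5Prop11Plancherel
open Literature.MathematicalPhysics.QuantumFieldTheory.Balaban1983to89.B5Prop11Lower (nsq nsq_nonneg)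
open Literature.MathematicalPhysics.QuantumFieldTheory.Balaban1983to89.B5G183RateTorusW (Qavg)
open Literature.MathematicalPhysics.QuantumFieldTheory.Balaban1983to89.B5G183RateUnitTower (lev lev_neZero)
open Summit.QuantumFields.BalabanUV.T4Continuum.CovariantAveragingTower (Atow)
open Summit.QuantumFields.BalabanUV.T4Continuum.BalabanAveragedTowerUnit (idx lev_succ' one_le_lev' cast_lev' QBlev calGlev)
open Summit.QuantumFields.BalabanUV.T4Continuum.BalabanAveragedTowerModes (par rem par_cpt_add_off rem_cpt_add_off)
open Summit.QuantumFields.BalabanUV.T4Continuum.BalabanBlockPoincare (tileEquiv Qavg_conjTranspose_mul_apply)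
open Summit.QuantumFields.BalabanUV.T4Continuum.BalabanMinimizerLaw
open Summit.QuantumFields.BalabanUV.Beta.GAN24.ChainLeibniz

variable {d : ℕ} (L : ℕ) [NeZero L] (M : Fin d → ℕ) [hM : ∀ μ, NeZero (M μ)]

/-! ## §1 The staircase's entries; the `ℓ²` size of the columns and of the differenced columns -/

omit hM in
/-- `√((L^d)^k) > 0`. [folklore] -/
theorem sqrt_pow_pos (k : ℕ) : 0 < Real.sqrt (((L : ℝ) ^ d) ^ k) :=
  Real.sqrt_pos.mpr (pow_pos (pow_pos (by exact_mod_cast Nat.pos_of_ne_zero (NeZero.ne L)) d) k)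

omit [NeZero L] hM in
/-- `√((L^d)^{k+1}) = √(L^d)·√((L^d)^k)`. [folklore] -/
theorem sqrt_pow_succ (k : ℕ) :
    Real.sqrt (((L : ℝ) ^ d) ^ (k + 1)) = Real.sqrt ((L : ℝ) ^ d) * Real.sqrt (((L : ℝ) ^ d) ^ k) := by
  have hLd : (0 : ℝ) ≤ (L : ℝ) ^ d := pow_nonneg (Nat.cast_nonneg _) d
  rw [pow_succ, mul_comm, Real.sqrt_mul hLd]

/-- **THE STAIRCASE's ENTRIES**: `(J_k u)(x′) = (√(L^d))⁻¹ · u(par x′, same component)`. [cite: King1986, p.664 (convention before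
Prop. 3.8), (2.10) p.653] [folklore] -/
theorem Jpc_mulVec_apply (k : ℕ) (u : idx L M k → ℂ) (x' : Tor (fine (L * lev L k) M) × Fin d) :
    (Jpc L M k *ᵥ u) x' = ((Real.sqrt ((L : ℝ) ^ d) : ℝ) : ℂ)⁻¹ * u (par (lev L k) L M x'.1, x'.2) := by
  have hLd : (0 : ℝ) < (L : ℝ) ^ d := pow_pos (by exact_mod_cast Nat.pos_of_ne_zero (NeZero.ne L)) d
  have hs : (((Real.sqrt ((L : ℝ) ^ d) : ℝ) : ℂ)) ≠ 0 := by exact_mod_cast (Real.sqrt_pos.mpr (pow_pos (by exact_mod_cast Nat.pos_of_ne_zero (NeZero.ne L)) d) : 0 < Real.sqrt ((L : ℝ) ^ d)).ne'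
  have hss : (((Real.sqrt ((L : ℝ) ^ d) : ℝ) : ℂ)) * ((Real.sqrt ((L : ℝ) ^ d) : ℝ) : ℂ) = (L : ℂ) ^ d := by
    rw [← Complex.ofReal_mul, Real.mul_self_sqrt hLd.le]; push_cast; rfl
  set Y : Matrix (idx L M k) Unit ℂ := Matrix.of fun X _ => u X with hY
  have e : (Jpc L M k *ᵥ u) x' = (((Real.sqrt ((L : ℝ) ^ d) : ℝ) : ℂ)) * ((Qavg (lev L k) L M)ᴴ * Y) x' () := by
    rw [Jpc, Matrix.smul_mulVec, Pi.smul_apply, smul_eq_mul]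
    congr 1
  rw [e, Qavg_conjTranspose_mul_apply]
  simp only [hY, Matrix.of_apply]
  rw [← mul_assoc]
  congr 1
  rw [← hss, mul_inv, ← mul_assoc, mul_inv_cancel₀ hs, one_mul]

/-- pointwise size of a staircased field: `‖(J_k u)(x′)‖ = (√(L^d))⁻¹·‖u(par x′)‖`. [folklore] -/
theorem norm_Jpc_mulVec_apply (k : ℕ) (u : idx L M k → ℂ) (x' : Tor (fine (L * lev L k) M) × Fin d) :
    ‖(Jpc L M k *ᵥ u) x'‖ = (Real.sqrt ((L : ℝ) ^ d))⁻¹ * ‖u (par (lev L k) L M x'.1, x'.2)‖ := by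
  rw [Jpc_mulVec_apply, norm_mul, norm_inv, Complex.norm_real, Real.norm_of_nonneg (Real.sqrt_pos.mpr (pow_pos (by exact_mod_cast Nat.pos_of_ne_zero (NeZero.ne L)) d) : 0 < Real.sqrt ((L : ℝ) ^ d)).le]

variable (a : ℝ) (ha : 0 < a)

/-- **`‖M̃_k‖ ≤ a·Cst(d,a)`**, uniformly in `k` (`‖𝒢‖ ≤ Cst` by [B5] Prop. 1.1 as certified in `B5Prop11Plancherel.opNorm_calG_le`,
`‖QBtow_k‖ ≤ n_k^{−d/2}`). [folklore] -/
theorem opNorm_Mtil_le (k : ℕ) : ‖Mtil L M a ha k‖ ≤ a * Cst d a := by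
  have ht0 := sqrt_pow_pos (d := d) L k
  have hG : ‖calGlev L M a ha k‖ ≤ Cst d a := opNorm_calG_le (lev L k) (one_le_lev' L k) M a ha
  have hA : ‖(Atow (QBlev L M) k)ᴴ‖ ≤ (Real.sqrt (((L : ℝ) ^ d) ^ k))⁻¹ := by
    rw [Matrix.l2_opNorm_conjTranspose]; exact opNorm_Atow_QBlev_le L M k
  rw [Mtil, norm_smul, Complex.norm_real, Real.norm_of_nonneg (mul_nonneg ht0.le ha.le)]
  calc Real.sqrt (((L : ℝ) ^ d) ^ k) * a * ‖calGlev L M a ha k * (Atow (QBlev L M) k)ᴴ‖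
      ≤ Real.sqrt (((L : ℝ) ^ d) ^ k) * a * (Cst d a * (Real.sqrt (((L : ℝ) ^ d) ^ k))⁻¹) := by
        refine mul_le_mul_of_nonneg_left ?_ (mul_nonneg ht0.le ha.le)
        exact (Matrix.l2_opNorm_mul _ _).trans (mul_le_mul hG hA (norm_nonneg _) (Cst_nonneg d a))
    _ = a * Cst d a := by field_simp

/-- the unit-sourced SOFT LEG at level `k`: the column `M̃_k e_q`. [folklore] -/
def col (k : ℕ) (q : idx L M 0) : idx L M k → ℂ := (Mtil L M a ha k).col q

/-- the leg's `ℓ²` size: `nsq (M̃_k e_q) ≤ (a·Cst)²`. [folklore] -/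
theorem nsq_col_Mtil_le (k : ℕ) (q : idx L M 0) : nsq (col L M a ha k q) ≤ (a * Cst d a) ^ 2 :=
  (nsq_col_le _ q).trans (pow_le_pow_left₀ (norm_nonneg _) (opNorm_Mtil_le L M a ha k) 2)

/-- the level-`(k+1)` leg read at the syntactic successor level `L·n_k` (identity transport `atSucc'`; the index types are
definitionally equal). [folklore] -/
def colS (k : ℕ) (q : idx L M 0) : Tor (fine (L * lev L k) M) × Fin d → ℂ := (atSucc' L M k (Mtil L M a ha (k + 1))).col q

/-- `colS k = col (k+1)` (definitional). [folklore] -/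
theorem colS_eq (k : ℕ) (q : idx L M 0) : colS L M a ha k q = col L M a ha (k + 1) q := rfl

/-- the leg's `ℓ²` size at the successor level. [folklore] -/
theorem nsq_colS_le (k : ℕ) (q : idx L M 0) : nsq (colS L M a ha k q) ≤ (a * Cst d a) ^ 2 := nsq_col_Mtil_le L M a ha (k + 1) q

/-- the DIFFERENCED leg at the finer level: `(M̃_{k+1} − J_kM̃_k)e_q = M̃_{k+1}e_q − J_k(M̃_ke_q)`. [folklore] -/
theorem col_step_eq (k : ℕ) (q : idx L M 0) :
    (atSucc' L M k (Mtil L M a ha (k + 1)) - Jpc L M k * Mtil L M a ha k).col q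
      = colS L M a ha k q - Jpc L M k *ᵥ col L M a ha k q := by
  funext x'
  rw [Matrix.col_apply, Matrix.sub_apply, Pi.sub_apply, Matrix.mul_apply, Matrix.mulVec, dotProduct]
  rfl

/-- **the differenced leg's `ℓ²` size**: `nsq (M̃_{k+1}e_q − J_kM̃_ke_q) ≤ (a·CQH·L^{−k})²` (`opNorm_Mtil_succ_sub_le` BY NAME). [folklore] -/
theorem nsq_col_step_le (k : ℕ) (q : idx L M 0) :
    nsq (colS L M a ha k q - Jpc L M k *ᵥ col L M a ha k q) ≤ (a * CQH d a * ((L : ℝ)⁻¹) ^ k) ^ 2 := by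
  rw [← col_step_eq]
  exact (nsq_col_le _ q).trans (pow_le_pow_left₀ (norm_nonneg _) (opNorm_Mtil_succ_sub_le L M a ha k) 2)

/-- the staircased leg's `ℓ²` size: `nsq (J_k(M̃_ke_q)) ≤ (a·Cst)²` (`‖J_k‖ ≤ 1`). [folklore] -/
theorem nsq_Jpc_col_le (k : ℕ) (q : idx L M 0) : nsq (Jpc L M k *ᵥ col L M a ha k q) ≤ (a * Cst d a) ^ 2 := by
  refine (nsq_mulVec_le_rect _ _).trans ?_
  have hJ : ‖Jpc L M k‖ ^ 2 ≤ 1 := by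
    have := opNorm_Jpc_le L M k
    calc ‖Jpc L M k‖ ^ 2 ≤ 1 ^ 2 := pow_le_pow_left₀ (norm_nonneg _) this 2
      _ = 1 := one_pow 2
  calc ‖Jpc L M k‖ ^ 2 * nsq (col L M a ha k q) ≤ 1 * (a * Cst d a) ^ 2 :=
        mul_le_mul hJ (nsq_col_Mtil_le L M a ha k q) (nsq_nonneg _) zero_le_one
    _ = (a * Cst d a) ^ 2 := one_mul _

/-! ## §2 UNCONDITIONAL: the two-leg Gram pairing `W_k = M̃_kᴴM̃_k` is entrywise Cauchy at rate `L^{−k}` -/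

/-- the algebra: `M̃′ᴴM̃′ − M̃ᴴM̃ = M̃′ᴴ(M̃′ − JM̃) + (M̃′ − JM̃)ᴴ(JM̃)` (`JᴴJ = 1`). [folklore] -/
theorem gram_succ_sub_eq (k : ℕ) :
    (atSucc' L M k (Mtil L M a ha (k + 1)))ᴴ * atSucc' L M k (Mtil L M a ha (k + 1)) - (Mtil L M a ha k)ᴴ * Mtil L M a ha k
      = (atSucc' L M k (Mtil L M a ha (k + 1)))ᴴ * (atSucc' L M k (Mtil L M a ha (k + 1)) - Jpc L M k * Mtil L M a ha k)
        + (atSucc' L M k (Mtil L M a ha (k + 1)) - Jpc L M k * Mtil L M a ha k)ᴴ * (Jpc L M k * Mtil L M a ha k) := by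
  have hJ : (Jpc L M k * Mtil L M a ha k)ᴴ * (Jpc L M k * Mtil L M a ha k) = (Mtil L M a ha k)ᴴ * Mtil L M a ha k := by
    rw [Matrix.conjTranspose_mul, Matrix.mul_assoc, ← Matrix.mul_assoc (Jpc L M k)ᴴ, Jpc_conjTranspose_mul_Jpc, Matrix.one_mul]
  rw [← hJ, Matrix.mul_sub, Matrix.conjTranspose_sub, Matrix.sub_mul]
  abel

/-- **THE TWO-LEG PAIRING IS ENTRYWISE CAUCHY, UNCONDITIONALLY**: with `W_k := M̃_kᴴM̃_k` (entries `⟨M̃_ke_p, M̃_ke_r⟩` = the unit-lattice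
kernel `a²·n_k^d·QBtow_k𝒢²QBtow_kᴴ`), `‖W_{k+1}(p,r) − W_k(p,r)‖ ≤ 2·(a·Cst)·(a·CQH·L^{−k})` for all unit sites∕components `p, r`, every
torus, every `L ≥ 1`. [folklore] -/
theorem norm_gram_succ_sub_le (k : ℕ) (p r : idx L M 0) :
    ‖((atSucc' L M k (Mtil L M a ha (k + 1)))ᴴ * atSucc' L M k (Mtil L M a ha (k + 1))
        - (Mtil L M a ha k)ᴴ * Mtil L M a ha k) p r‖ ≤ 2 * ((a * Cst d a) * (a * CQH d a * ((L : ℝ)⁻¹) ^ k)) := by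
  have hM' : ‖atSucc' L M k (Mtil L M a ha (k + 1))‖ ≤ a * Cst d a := opNorm_Mtil_le L M a ha (k + 1)
  have hD := opNorm_Mtil_succ_sub_le L M a ha k
  have hJM : ‖Jpc L M k * Mtil L M a ha k‖ ≤ a * Cst d a :=
    (Matrix.l2_opNorm_mul _ _).trans ((mul_le_mul (opNorm_Jpc_le L M k) (opNorm_Mtil_le L M a ha k) (norm_nonneg _)
      zero_le_one).trans (le_of_eq (one_mul _)))
  have h0 : 0 ≤ a * CQH d a * ((L : ℝ)⁻¹) ^ k := (norm_nonneg _).trans hD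
  rw [gram_succ_sub_eq, Matrix.add_apply]
  refine (norm_add_le _ _).trans ?_
  have t1 := (norm_conjTranspose_mul_apply_le (atSucc' L M k (Mtil L M a ha (k + 1)))
    (atSucc' L M k (Mtil L M a ha (k + 1)) - Jpc L M k * Mtil L M a ha k) p r).trans
    (mul_le_mul hM' hD (norm_nonneg _) (mul_nonneg ha.le (Cst_nonneg d a)))
  have t2 := (norm_conjTranspose_mul_apply_le (atSucc' L M k (Mtil L M a ha (k + 1)) - Jpc L M k * Mtil L M a ha k)
    (Jpc L M k * Mtil L M a ha k) p r).trans (mul_le_mul hD hJM (norm_nonneg _) h0)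
  calc _ ≤ a * Cst d a * (a * CQH d a * ((L : ℝ)⁻¹) ^ k) + a * CQH d a * ((L : ℝ)⁻¹) ^ k * (a * Cst d a) := add_le_add t1 t2
    _ = 2 * ((a * Cst d a) * (a * CQH d a * ((L : ℝ)⁻¹) ^ k)) := by ring

/-! ## §3 The local vertex functionals on the tower and their EXACT transport under the staircase -/

/-- **each `L`-block of the finer torus has `L^d` sites**: `Σ_{x′} F(par x′) = L^d·Σ_x F(x)` (`BalabanBlockPoincare.tileEquiv` +
`ChainLeibniz.sum_comp_fst_equiv`). [folklore] -/
theorem sum_comp_par (n : ℕ) [NeZero n] (F : Tor (fine n M) → ℂ) :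
    ∑ x' : Tor (fine (L * n) M), F (par n L M x') = (L : ℂ) ^ d * ∑ x, F x := by
  have h := sum_comp_fst_equiv (tileEquiv n L M).symm F
  have hcard : (Fintype.card (Fin d → Fin L) : ℂ) = (L : ℂ) ^ d := by
    rw [Fintype.card_fun, Fintype.card_fin, Fintype.card_fin]; push_cast; rfl
  rw [hcard] at h
  refine Eq.trans (Finset.sum_congr rfl fun x' _ => ?_) h
  rfl

/-- **THE THREE-COLUMN LOCAL VERTEX FUNCTIONAL at level `k`, physically normalised**: `V₃ k c f g h = √(n_k^d)·Σ_x Σ_{ijl} c i j l·f(x,i)g(x,j)h(x,l)`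
on any finite site set `α` (for physical legs `u = √(n_k^d)·f` etc. this is `Σ_x η_k^d Σ c·u u′ u″`, the `η^d`-weighted local cubic vertex).
[folklore] -/
def V₃ (k : ℕ) {α : Type*} [Fintype α] (c : Fin d → Fin d → Fin d → ℂ) (f g h : α × Fin d → ℂ) : ℂ :=
  ((Real.sqrt (((L : ℝ) ^ d) ^ k) : ℝ) : ℂ) * vtx₃ c f g h

/-- the un-normalised transport: `vtx₃ c (Jf) (Jg) (Jh) = (√(L^d))⁻¹ · vtx₃ c f g h` (`L^d` sites per block, three factors `(√(L^d))⁻¹`).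
[folklore] -/
theorem vtx₃_Jpc (k : ℕ) (c : Fin d → Fin d → Fin d → ℂ) (f g h : idx L M k → ℂ) :
    vtx₃ c (Jpc L M k *ᵥ f) (Jpc L M k *ᵥ g) (Jpc L M k *ᵥ h) = ((Real.sqrt ((L : ℝ) ^ d) : ℝ) : ℂ)⁻¹ * vtx₃ c f g h := by
  set s : ℂ := ((Real.sqrt ((L : ℝ) ^ d) : ℝ) : ℂ) with hs_def
  have hs : s ≠ 0 := by rw [hs_def]; exact_mod_cast (Real.sqrt_pos.mpr (pow_pos (by exact_mod_cast Nat.pos_of_ne_zero (NeZero.ne L)) d) : 0 < Real.sqrt ((L : ℝ) ^ d)).ne'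
  have hss : s * s = (L : ℂ) ^ d := by
    rw [hs_def, ← Complex.ofReal_mul, Real.mul_self_sqrt (pow_nonneg (Nat.cast_nonneg _) d)]; push_cast; rfl
  -- rewrite every staircased value and pull the scalar out
  have e1 : vtx₃ c (Jpc L M k *ᵥ f) (Jpc L M k *ᵥ g) (Jpc L M k *ᵥ h)
      = ∑ x' : Tor (fine (L * lev L k) M), (s⁻¹ * s⁻¹ * s⁻¹) *
          ∑ i, ∑ j, ∑ l, c i j l * (f (par (lev L k) L M x', i) * g (par (lev L k) L M x', j) * h (par (lev L k) L M x', l)) := by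
    rw [vtx₃]
    refine Finset.sum_congr rfl fun x' _ => ?_
    simp only [Jpc_mulVec_apply, Finset.mul_sum]
    refine Finset.sum_congr rfl fun i _ => Finset.sum_congr rfl fun j _ => Finset.sum_congr rfl fun l _ => ?_
    rw [← hs_def]; ring
  have e2 : ∑ x' : Tor (fine (L * lev L k) M), (s⁻¹ * s⁻¹ * s⁻¹) *
          ∑ i, ∑ j, ∑ l, c i j l * (f (par (lev L k) L M x', i) * g (par (lev L k) L M x', j) * h (par (lev L k) L M x', l))
      = (s⁻¹ * s⁻¹ * s⁻¹) * ((L : ℂ) ^ d * vtx₃ c f g h) := by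
    rw [← Finset.mul_sum, vtx₃,
      sum_comp_par L M (lev L k) (fun x => ∑ i, ∑ j, ∑ l, c i j l * (f (x, i) * g (x, j) * h (x, l)))]
  rw [e1, e2, ← hss]
  field_simp

/-- **EXACT TRANSPORT OF THE THREE-COLUMN VERTEX**: `V₃ (k+1) c (J_kf) (J_kg) (J_kh) = V₃ k c f g h` — the finer-level vertex of the
staircased columns IS the coarser-level vertex. [folklore] -/
theorem V₃_transport (k : ℕ) (c : Fin d → Fin d → Fin d → ℂ) (f g h : idx L M k → ℂ) :
    V₃ L (k + 1) c (Jpc L M k *ᵥ f) (Jpc L M k *ᵥ g) (Jpc L M k *ᵥ h) = V₃ L k c f g h := by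
  have hs : (((Real.sqrt ((L : ℝ) ^ d) : ℝ) : ℂ)) ≠ 0 := by exact_mod_cast (Real.sqrt_pos.mpr (pow_pos (by exact_mod_cast Nat.pos_of_ne_zero (NeZero.ne L)) d) : 0 < Real.sqrt ((L : ℝ) ^ d)).ne'
  rw [V₃, V₃, vtx₃_Jpc, sqrt_pow_succ, Complex.ofReal_mul]
  calc (((Real.sqrt ((L : ℝ) ^ d) : ℝ) : ℂ)) * ((Real.sqrt (((L : ℝ) ^ d) ^ k) : ℝ) : ℂ)
        * ((((Real.sqrt ((L : ℝ) ^ d) : ℝ) : ℂ))⁻¹ * vtx₃ c f g h)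
      = ((((Real.sqrt ((L : ℝ) ^ d) : ℝ) : ℂ)) * (((Real.sqrt ((L : ℝ) ^ d) : ℝ) : ℂ))⁻¹)
          * (((Real.sqrt (((L : ℝ) ^ d) ^ k) : ℝ) : ℂ) * vtx₃ c f g h) := by ring
    _ = ((Real.sqrt (((L : ℝ) ^ d) ^ k) : ℝ) : ℂ) * vtx₃ c f g h := by rw [mul_inv_cancel₀ hs, one_mul]

/-! ## §4 The one-step sup rate of the column vertex chains, modulo ONE sup letter -/

/-- the letter rescaled to the staircased column: `√(n_{k+1}^d)·‖(J_k u)(x′)‖ = √(n_k^d)·‖u(par x′)‖`. [folklore] -/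
theorem sqrt_mul_norm_Jpc_mulVec (k : ℕ) (u : idx L M k → ℂ) (x' : Tor (fine (L * lev L k) M) × Fin d) :
    Real.sqrt (((L : ℝ) ^ d) ^ (k + 1)) * ‖(Jpc L M k *ᵥ u) x'‖
      = Real.sqrt (((L : ℝ) ^ d) ^ k) * ‖u (par (lev L k) L M x'.1, x'.2)‖ := by
  rw [norm_Jpc_mulVec_apply, sqrt_pow_succ]
  calc Real.sqrt ((L : ℝ) ^ d) * Real.sqrt (((L : ℝ) ^ d) ^ k) * ((Real.sqrt ((L : ℝ) ^ d))⁻¹ * ‖u (par (lev L k) L M x'.1, x'.2)‖)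
      = (Real.sqrt ((L : ℝ) ^ d) * (Real.sqrt ((L : ℝ) ^ d))⁻¹) * (Real.sqrt (((L : ℝ) ^ d) ^ k) * ‖u (par (lev L k) L M x'.1, x'.2)‖) := by
        ring
    _ = Real.sqrt (((L : ℝ) ^ d) ^ k) * ‖u (par (lev L k) L M x'.1, x'.2)‖ := by
        rw [mul_inv_cancel₀ (Real.sqrt_pos.mpr (pow_pos (by exact_mod_cast Nat.pos_of_ne_zero (NeZero.ne L)) d) : 0 < Real.sqrt ((L : ℝ) ^ d)).ne', one_mul]

omit hM in
/-- from the letter `√(n_k^d)·‖u X‖ ≤ C` to the pointwise bound `‖u X‖ ≤ C∕√(n_k^d)`. [folklore] -/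
theorem norm_le_div_of_letter {k : ℕ} {ι : Type*} {u : ι → ℂ} {C : ℝ}
    (h : ∀ X, Real.sqrt (((L : ℝ) ^ d) ^ k) * ‖u X‖ ≤ C) (X : ι) : ‖u X‖ ≤ C / Real.sqrt (((L : ℝ) ^ d) ^ k) := by
  rw [le_div_iff₀ (sqrt_pow_pos (d := d) L k), mul_comm]; exact h X

/-- **THE ONE-STEP SUP RATE OF THE THREE-COLUMN VERTEX CHAIN, MODULO ONE SUP LETTER.**  Hypothesis (DISPLAYED, the only one):
`hcol : ∀ k q X, √(n_k^d)·‖M̃_k X q‖ ≤ C_∞` — the k-uniform POINTWISE bound of the physical soft leg ([B5] (1.65)∕(1.110)-type; a BOUND,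
not a rate).  Conclusion, for every coefficient tensor `c`, all unit sites∕components `p q r`, every `k`:
`‖V₃ (k+1) c [M̃_{k+1}e_p, M̃_{k+1}e_q, M̃_{k+1}e_r] − V₃ k c [M̃_ke_p, M̃_ke_q, M̃_ke_r]‖ ≤ 3·‖c‖₁·C_∞·(a·Cst)·(a·CQH)·L^{−k}` —
SupRate `θ₁ = L⁻¹`.  Transport (exact) + Leibniz (exact) + differenced column in `ℓ²` (`opNorm_Mtil_succ_sub_le`) + one neighbour in sup
(the letter) + one in `ℓ²`. [folklore] -/
theorem V₃_col_succ_sub_le {C : ℝ} (hC : 0 ≤ C)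
    (hcol : ∀ (k : ℕ) (q : idx L M 0) (X : idx L M k), Real.sqrt (((L : ℝ) ^ d) ^ k) * ‖Mtil L M a ha k X q‖ ≤ C)
    (c : Fin d → Fin d → Fin d → ℂ) (p q r : idx L M 0) (k : ℕ) :
    ‖V₃ L (k + 1) c (colS L M a ha k p) (colS L M a ha k q) (colS L M a ha k r)
        - V₃ L k c (col L M a ha k p) (col L M a ha k q) (col L M a ha k r)‖
      ≤ 3 * (cnorm₃ c * (C * ((a * Cst d a) * (a * CQH d a * ((L : ℝ)⁻¹) ^ k)))) := by
  have ht := sqrt_pow_pos (d := d) L (k + 1)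
  have hA : 0 ≤ a * Cst d a := mul_nonneg ha.le (Cst_nonneg d a)
  have hε : 0 ≤ a * CQH d a * ((L : ℝ)⁻¹) ^ k := (norm_nonneg _).trans (opNorm_Mtil_succ_sub_le L M a ha k)
  -- transport the coarse vertex to the fine level
  rw [← V₃_transport L M k c]
  -- the sup letters at level k+1, as pointwise bounds `≤ C ∕ √(n_{k+1}^d)`
  set B : ℝ := C / Real.sqrt (((L : ℝ) ^ d) ^ (k + 1)) with hB_def
  have hB : 0 ≤ B := div_nonneg hC ht.le
  have hsup' : ∀ (q' : idx L M 0) (z : Tor (fine (L * lev L k) M) × Fin d), ‖colS L M a ha k q' z‖ ≤ B := fun q' z =>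
    norm_le_div_of_letter L (fun X => hcol (k + 1) q' X) z
  have hsupJ : ∀ (q' : idx L M 0) (z : Tor (fine (L * lev L k) M) × Fin d), ‖(Jpc L M k *ᵥ col L M a ha k q') z‖ ≤ B := by
    intro q' z
    refine norm_le_div_of_letter L (k := k + 1) (fun X => ?_) z
    rw [sqrt_mul_norm_Jpc_mulVec]
    exact hcol k q' _
  -- Leibniz in the demoted currency at level k+1
  have key := norm_vtx₃_sub_vtx₃_le c (Jpc L M k *ᵥ col L M a ha k p) (Jpc L M k *ᵥ col L M a ha k q)
    (Jpc L M k *ᵥ col L M a ha k r) (colS L M a ha k p) (colS L M a ha k q) (colS L M a ha k r) hε hA hB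
    (nsq_col_step_le L M a ha k p) (nsq_col_step_le L M a ha k q) (nsq_col_step_le L M a ha k r)
    (nsq_Jpc_col_le L M a ha k q) (nsq_colS_le L M a ha k r) (hsup' q) (hsupJ p)
  -- multiply by the physical normalisation `√(n_{k+1}^d)` and cancel it against `B`
  rw [V₃, V₃, ← mul_sub, norm_mul, Complex.norm_real, Real.norm_of_nonneg ht.le]
  calc Real.sqrt (((L : ℝ) ^ d) ^ (k + 1)) * ‖vtx₃ c (colS L M a ha k p) (colS L M a ha k q) (colS L M a ha k r)
          - vtx₃ c (Jpc L M k *ᵥ col L M a ha k p) (Jpc L M k *ᵥ col L M a ha k q) (Jpc L M k *ᵥ col L M a ha k r)‖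
      ≤ Real.sqrt (((L : ℝ) ^ d) ^ (k + 1)) * (3 * (cnorm₃ c * (B * ((a * Cst d a) * (a * CQH d a * ((L : ℝ)⁻¹) ^ k))))) :=
        mul_le_mul_of_nonneg_left key ht.le
    _ = 3 * (cnorm₃ c * ((Real.sqrt (((L : ℝ) ^ d) ^ (k + 1)) * B) * ((a * Cst d a) * (a * CQH d a * ((L : ℝ)⁻¹) ^ k)))) := by
        ring
    _ = 3 * (cnorm₃ c * (C * ((a * Cst d a) * (a * CQH d a * ((L : ℝ)⁻¹) ^ k)))) := by
        rw [hB_def, mul_div_cancel₀ _ ht.ne']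

end Summit.QuantumFields.BalabanUV.Beta.GAN24.SoftColumnVertexRate

end
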